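import Summits.QuantumFields.BalabanUV.Beta.GAN24.DerivativeRateTransferJensenMassFreeConvention
import Summits.QuantumFields.BalabanUV.Beta.GAN24.DerivativeRateTransferJensenMassFreeLogarithm

/-!
# `BalabanUV.Beta.GAN24.DerivativeRateTransferJensenMassFreeConventionEnd` — binder row G-an2-4 ∕ (CONV-C), route R6 «VALUES, NOT DERIVATIVES», PART 70:
# ONE CONVENTION SUFFICES — FROM THE TRANSPORTS.  For orthogonal open transports `τ_x` and a base transport `τ₀` whose loops `τ_xτ₀ᵀ` are within `D ≤ 1∕8`
# of `1` (Frobenius), the logarithms `A_x = log(τ_xτ₀ᵀ)` EXIST, are skew and of size `≤ 2D` (PART 69); Bałaban–Jaffe's (1.28) link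
# `R_B = exp(Σ_x q_xA_x)·τ₀` is thereby DEFINED from the transports, a polar link `R′` EXISTS (PART 58), and EVERY polar link satisfies
#   `‖R′ − R_B‖ ≤ 20·D³ + 784·D⁴`   and PART 56's transfer letter   `|(R_B − R′)w|² ≤ (20D³ + 784D⁴)²·|w|²`
# — the «τ PAPER» word of the polar display typed end to end: τ is THIRD ORDER in the loop letter (unit b2b-balaban-gan24-p3, gen 45; v1)

NOT IN PRINT; OUR PROOF (for the ROUTE; PART 68 `frob_norm_polar_sub_expMean_base_le` ∕ `exists_polar_near_expMean` + PART 69 `exists_skew_logs_of_transports`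
∕ `frob_norm_le_sqrt_card_mul` BY NAME).  HONEST FRAMING (cell contract, verbatim): «discharging `BetaPertH` makes Bałaban's UV stability UNCONDITIONAL — a
real constructive-QFT result; it is NOT the continuum limit and NOT the Clay problem.»  HONEST DEPENDENCY (verbatim): «continuum YM on T⁴ ⇐ BetaPertH ∧
nine spine estimates (0/9 proved); BetaPertH ⇐ (D1) ∧ (D4) ∧ CAP+tail; G-an2-4 gates asym, D1 and NE2/3/4.»

WHAT THIS FILE PROVES (0 sorry, 0 `def`, nothing cited; `s = 2D` in PART 68: `(5∕2)(2D)³ + 49(2D)⁴ = 20D³ + 784D⁴`):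
* §1 `wsum_congr_of_logs` (`Σ_x q_x•τ_x = Σ_x q_x•(exp(A_x)·τ₀)`), **`polar_sub_expMeanLink_of_transports`** (∃ skew logs; every polar link of `Σ_x q_x•τ_x`
  is within `20D³ + 784D⁴` of `exp(Ā)·τ₀`), **`exists_polar_and_expMeanLink_of_transports`** (… and a polar link exists),
  **`transferLetter_of_transports`** (the bond-indexed `hτ` letter of PART 56 `covJensen_transfer` for `R″ = exp(Ā)·τ₀` against any polar family `R′`).
* §2 the pointwise-letter entrance **`polar_sub_expMeanLink_of_loopLetter`**: the lineage's loop letter `|(τ_xτ₀ᵀ − 1)w|² ≤ D²|w|²` with `√(card o)·D ≤ 1∕8`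
  gives the same with `D ↦ √(card o)·D`.
WHAT IT DOES NOT DO: identify `τ₀` with the central contour of a particular block geometry (any orthogonal base works; PART 63's comb transporters supply
`τ(e′,x)` and the loop letter with `D = 2d(L−1)Lp̂` in the OPERATOR form — the Frobenius form costs `√(dim o)`), the Karcher mean's existence, structure
groups beyond the orthogonal group, anything of Bałaban's, (CONS) ∕ exact (STAB).  SUPPLIER work on route R6 (rank 2, REDUCTION, no seat); no consumer of
record; NEVER «G-an2-4 closed»; NOT (CONV-C), NOT D1, NOT `BetaPertH`, NOT continuum, NOT Clay.  Records: `HOME/b2b-balaban-gan24-p3/WOODBURY-FIBRE.md` v14.5. -/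

noncomputable section

open scoped Matrix Matrix.Norms.Frobenius
open NormedSpace Finset Matrix

namespace Summit.QuantumFields.BalabanUV.Beta.GAN24.DerivativeRateTransferJensenMassFreeConventionEnd

open Summit.QuantumFields.BalabanUV.Beta.GAN24.DerivativeRateTransferJensenMassFreePolarNear
open Summit.QuantumFields.BalabanUV.Beta.GAN24.DerivativeRateTransferJensenMassFreeConvention
open Summit.QuantumFields.BalabanUV.Beta.GAN24.DerivativeRateTransferJensenMassFreeLogarithm

variable {o ν : Type*} [Fintype o] [DecidableEq o] [Fintype ν]

/-! ## §1 From the transports: logarithms, the (1.28) link, and every polar link within `20D³ + 784D⁴` -/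

omit [DecidableEq o] in
/-- rewriting the mean transport through the logarithms. [folklore] -/
theorem wsum_congr_of_logs {q : ν → ℝ} {τ : ν → Matrix o o ℝ} {τ₀ : Matrix o o ℝ} {E : ν → Matrix o o ℝ} (hE : ∀ x, E x * τ₀ = τ x) :
    ∑ x, q x • τ x = ∑ x, q x • (E x * τ₀) :=
  Finset.sum_congr rfl fun x _ => by rw [hE x]

omit [Fintype o] [DecidableEq o] [Fintype ν] in
/-- arithmetic: `(5∕2)(2D)³ + 49(2D)⁴ = 20D³ + 784D⁴`. -/
theorem two_mul_cube_eq (D : ℝ) : 5 / 2 * (2 * D) ^ 3 + 49 * (2 * D) ^ 4 = 20 * D ^ 3 + 784 * D ^ 4 := by ring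

/-- **`polar_sub_expMeanLink_of_transports` — ONE CONVENTION SUFFICES, FROM THE TRANSPORTS** [our proof]: weights `q ≥ 0`, `Σq = 1`; orthogonal transports
`τ_x` and an orthogonal base `τ₀` with `‖τ_x·τ₀ᵀ − 1‖ ≤ D ≤ 1∕8` (Frobenius) ⟹ there are SKEW logarithms `A_x` (`exp(A_x)·τ₀ = τ_x`, `‖A_x‖ ≤ 2D`) and,
with `R_B := exp(Σ_x q_x•A_x)·τ₀` (Bałaban–Jaffe (1.28)), EVERY orthogonal `R′` with `(Σ_x q_x•τ_x)·R′ᵀ` symmetric positive semidefinite (a polar link,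
(1.26)) satisfies `‖R′ − R_B‖ ≤ 20D³ + 784D⁴`. -/
theorem polar_sub_expMeanLink_of_transports {q : ν → ℝ} (hq : ∀ x, 0 ≤ q x) (hq1 : ∑ x, q x = 1) {τ : ν → Matrix o o ℝ} {τ₀ : Matrix o o ℝ}
    (hτ : ∀ x, (τ x)ᵀ * τ x = 1) (hτ₀ : τ₀ᵀ * τ₀ = 1) {D : ℝ} (hD : ∀ x, ‖τ x * τ₀ᵀ - 1‖ ≤ D) (hD8 : D ≤ 1 / 8) :
    ∃ A : ν → Matrix o o ℝ, (∀ x, (A x)ᵀ = -A x) ∧ (∀ x, exp (A x) * τ₀ = τ x) ∧ (∀ x, ‖A x‖ ≤ 2 * D) ∧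
      ∀ R' : Matrix o o ℝ, R'ᵀ * R' = 1 → ((∑ x, q x • τ x) * R'ᵀ)ᵀ = (∑ x, q x • τ x) * R'ᵀ →
        (∀ w : o → ℝ, 0 ≤ w ⬝ᵥ (((∑ x, q x • τ x) * R'ᵀ) *ᵥ w)) →
        ‖R' - exp (∑ x, q x • A x) * τ₀‖ ≤ 20 * D ^ 3 + 784 * D ^ 4 := by
  obtain ⟨A, hAt, hA2, hA4, hAe⟩ := exists_skew_logs_of_transports hτ hτ₀ hD hD8
  refine ⟨A, hAt, hAe, hA2, fun R' hR' hsym hpsd => ?_⟩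
  have e := wsum_congr_of_logs (q := q) hAe
  rw [e] at hsym hpsd
  have h := frob_norm_polar_sub_expMean_base_le hq hq1 hAt hA2 (by linarith) hτ₀ hR' hsym hpsd
  rwa [two_mul_cube_eq] at h

/-- **`exists_polar_and_expMeanLink_of_transports`** [our proof]: under the same hypotheses a polar link EXISTS (PART 58; the mean transport is injective
since `2D ≤ 1∕4`), together with the logarithms and the bound `‖R′ − exp(Σ_x q_x•A_x)·τ₀‖ ≤ 20D³ + 784D⁴`. -/
theorem exists_polar_and_expMeanLink_of_transports {q : ν → ℝ} (hq : ∀ x, 0 ≤ q x) (hq1 : ∑ x, q x = 1) {τ : ν → Matrix o o ℝ}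
    {τ₀ : Matrix o o ℝ} (hτ : ∀ x, (τ x)ᵀ * τ x = 1) (hτ₀ : τ₀ᵀ * τ₀ = 1) {D : ℝ} (hD : ∀ x, ‖τ x * τ₀ᵀ - 1‖ ≤ D) (hD8 : D ≤ 1 / 8) :
    ∃ (A : ν → Matrix o o ℝ) (R' : Matrix o o ℝ), (∀ x, (A x)ᵀ = -A x) ∧ (∀ x, exp (A x) * τ₀ = τ x) ∧ (∀ x, ‖A x‖ ≤ 2 * D) ∧
      R'ᵀ * R' = 1 ∧ ((∑ x, q x • τ x) * R'ᵀ)ᵀ = (∑ x, q x • τ x) * R'ᵀ ∧ (∀ w : o → ℝ, 0 ≤ w ⬝ᵥ (((∑ x, q x • τ x) * R'ᵀ) *ᵥ w)) ∧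
      ‖R' - exp (∑ x, q x • A x) * τ₀‖ ≤ 20 * D ^ 3 + 784 * D ^ 4 := by
  obtain ⟨A, hAt, hA2, hA4, hAe⟩ := exists_skew_logs_of_transports hτ hτ₀ hD hD8
  have e := wsum_congr_of_logs (q := q) hAe
  obtain ⟨R', hR', hsym, hpsd, hb⟩ := exists_polar_near_expMean hq hq1 hAt hA2 (by linarith) hτ₀
  refine ⟨A, R', hAt, hAe, hA2, hR', ?_, ?_, ?_⟩
  · rw [e]; exact hsym
  · rw [e]; exact hpsd
  · rwa [two_mul_cube_eq] at hb

/-- **`transferLetter_of_transports` — PART 56's `hτ` FOR THE (1.28) LINK, FROM THE TRANSPORTS** [our proof]: bond-indexed orthogonal transports `τ e′ x`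
and bases `τ₀ e′` with loops within `D ≤ 1∕8` ⟹ there are skew logarithms `A e′ x` (`exp(A e′ x)·τ₀ e′ = τ e′ x`, `‖A e′ x‖ ≤ 2D`) such that for
`R″ e′ := exp(Σ_x q(src′e′,x)•A e′ x)·τ₀ e′` and EVERY polar family `R′` of the means `Σ_x q(src′e′,x)•τ e′ x`:
`∀ e′ w, |(R″e′ − R′e′)w|² ≤ (20D³ + 784D⁴)²·|w|²`. -/
theorem transferLetter_of_transports {μ β' : Type*} {q : μ → ν → ℝ} (hq : ∀ y x, 0 ≤ q y x) (hq1 : ∀ y, ∑ x, q y x = 1) {src' : β' → μ}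
    {τ : β' → ν → Matrix o o ℝ} {τ₀ : β' → Matrix o o ℝ} (hτ : ∀ e' x, (τ e' x)ᵀ * τ e' x = 1) (hτ₀ : ∀ e', (τ₀ e')ᵀ * τ₀ e' = 1) {D : ℝ}
    (hD : ∀ e' x, ‖τ e' x * (τ₀ e')ᵀ - 1‖ ≤ D) (hD8 : D ≤ 1 / 8) :
    ∃ A : β' → ν → Matrix o o ℝ, (∀ e' x, (A e' x)ᵀ = -A e' x) ∧ (∀ e' x, exp (A e' x) * τ₀ e' = τ e' x) ∧ (∀ e' x, ‖A e' x‖ ≤ 2 * D) ∧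
      ∀ R' : β' → Matrix o o ℝ, (∀ e', (R' e')ᵀ * R' e' = 1) →
        (∀ e', ((∑ x, q (src' e') x • τ e' x) * (R' e')ᵀ)ᵀ = (∑ x, q (src' e') x • τ e' x) * (R' e')ᵀ) →
        (∀ e' (w : o → ℝ), 0 ≤ w ⬝ᵥ (((∑ x, q (src' e') x • τ e' x) * (R' e')ᵀ) *ᵥ w)) →
        ∀ e' (w : o → ℝ), ((exp (∑ x, q (src' e') x • A e' x) * τ₀ e' - R' e') *ᵥ w) ⬝ᵥ
            ((exp (∑ x, q (src' e') x • A e' x) * τ₀ e' - R' e') *ᵥ w) ≤ (20 * D ^ 3 + 784 * D ^ 4) ^ 2 * (w ⬝ᵥ w) := by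
  have h : ∀ e', ∃ Ae : ν → Matrix o o ℝ, (∀ x, (Ae x)ᵀ = -Ae x) ∧ (∀ x, ‖Ae x‖ ≤ 2 * D) ∧ (∀ x, ‖Ae x‖ ≤ 1 / 4) ∧
      ∀ x, exp (Ae x) * τ₀ e' = τ e' x := fun e' => exists_skew_logs_of_transports (hτ e') (hτ₀ e') (hD e') hD8
  choose A hAt hA2 hA4 hAe using h
  refine ⟨A, hAt, hAe, hA2, fun R' hR' hsym hpsd e' w => ?_⟩
  have e := wsum_congr_of_logs (q := q (src' e')) (hAe e')
  have hb := frob_norm_polar_sub_expMean_base_le (hq (src' e')) (hq1 (src' e')) (hAt e') (hA2 e') (by linarith) (hτ₀ e') (hR' e')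
    (by rw [← e]; exact hsym e') (by rw [← e]; exact hpsd e')
  rw [two_mul_cube_eq, ← norm_neg, neg_sub] at hb
  refine (mulVec_dotProduct_self_le_frob _ w).trans (mul_le_mul_of_nonneg_right (pow_le_pow_left₀ (norm_nonneg _) hb 2) ?_)
  simpa only [dotProduct] using Finset.sum_nonneg fun i _ => mul_self_nonneg (w i)

/-! ## §2 The pointwise-letter entrance -/

/-- **`polar_sub_expMeanLink_of_loopLetter`** [our proof]: the lineage's pointwise loop letter `|(τ_xτ₀ᵀ − 1)w|² ≤ D²|w|²` (`0 ≤ D`,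
`√(card o)·D ≤ 1∕8`) gives `polar_sub_expMeanLink_of_transports` with `D ↦ √(card o)·D`. -/
theorem polar_sub_expMeanLink_of_loopLetter {q : ν → ℝ} (hq : ∀ x, 0 ≤ q x) (hq1 : ∑ x, q x = 1) {τ : ν → Matrix o o ℝ} {τ₀ : Matrix o o ℝ}
    (hτ : ∀ x, (τ x)ᵀ * τ x = 1) (hτ₀ : τ₀ᵀ * τ₀ = 1) {D : ℝ} (hD0 : 0 ≤ D)
    (hloop : ∀ x (w : o → ℝ), ((τ x * τ₀ᵀ - 1) *ᵥ w) ⬝ᵥ ((τ x * τ₀ᵀ - 1) *ᵥ w) ≤ D ^ 2 * (w ⬝ᵥ w))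
    (hD8 : Real.sqrt (Fintype.card o) * D ≤ 1 / 8) :
    ∃ A : ν → Matrix o o ℝ, (∀ x, (A x)ᵀ = -A x) ∧ (∀ x, exp (A x) * τ₀ = τ x) ∧ (∀ x, ‖A x‖ ≤ 2 * (Real.sqrt (Fintype.card o) * D)) ∧
      ∀ R' : Matrix o o ℝ, R'ᵀ * R' = 1 → ((∑ x, q x • τ x) * R'ᵀ)ᵀ = (∑ x, q x • τ x) * R'ᵀ →
        (∀ w : o → ℝ, 0 ≤ w ⬝ᵥ (((∑ x, q x • τ x) * R'ᵀ) *ᵥ w)) →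
        ‖R' - exp (∑ x, q x • A x) * τ₀‖ ≤ 20 * (Real.sqrt (Fintype.card o) * D) ^ 3 + 784 * (Real.sqrt (Fintype.card o) * D) ^ 4 :=
  polar_sub_expMeanLink_of_transports hq hq1 hτ hτ₀ (fun x => frob_norm_le_sqrt_card_mul hD0 (hloop x)) hD8

end Summit.QuantumFields.BalabanUV.Beta.GAN24.DerivativeRateTransferJensenMassFreeConventionEnd
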